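import Summits.ResolutionOfSingularities.ResolutionOfSingularities.Theorems.FrobeniusClosingSteerCore4IsoChartStepConstruct
import Mathlib.FieldTheory.Separable
import Mathlib.FieldTheory.Perfect
import Mathlib.RingTheory.Polynomial.Tower
import HarnessLib

/-!
# Crux `Steer` (stmt-16345), chain W4.1 — dictionary piece T2 `chart_step`, file 4/5: FC2 for the new chart
# (the SEPARABILITY argument at a possibly non-rational centre)

OURS (campaign `res-hironaka`, rung L, slot W4.1; helper toward the registered stub `stub_core4Iso` of
reshape r8 of line `switching_dichotomy`, lead res-L0-w41-lead-1's `DICT-SIGS.lean` piece T2 = seam T2c;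
replaces the role of no printed item; NOT a statement of the manuscript under review; AI-produced).
Theses-free.

* `exists_aeval_eq_sub_mul_unit` — a SIMPLE root `a` of a separable `P ∈ κ[T]` gives
  `P(V) = (V − a)·unit` in `κ⟦X⟧` whenever `V(0) = a`.
* `sum_inverse_combination` — the linear-algebra identity `Σ_m C_{lm}((Σ_s M_{ms}Θ_s) − a_m L) = Θ_l − ξ_l L`
  for `C M = 1`, `a = M ξ`.
* `map_centre_eq_span_X` (**T2c**) — for the chart `φ₁` of the quadratic transform produced by
  `exists_chart_locAtCentre` (its four properties are taken as hypotheses), the centre of `O` on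
  `(R[𝔪_R/x])_{𝔪_O ∩ R[𝔪_R/x]}` generates `(X_1, …, X_d)`: `⊆` from FC1; `⊇` from `X_j = φ₁(x)·w⁻¹` and,
  for each old generator `u_m` with residue `a_m = res(u_m/x)` — algebraic and SEPARABLE over the perfect
  subfield `k₀ ⊆ res(R)` of `κ` — the element `z_m = P_m(u_m/x)` of the new centre (`P_m` the minimal
  polynomial of `a_m` with coefficients lifted to `R`), whose image is `(φ₁(u_m/x) − a_m)·unit` modulo
  `(X_j)`; unwinding the strict transforms (`φ₁(u_m/x)·w = W_m ≡ ℓ_{u_m}`, `w ≡ ℓ_x` mod `X_j`) puts the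
  linear forms `ℓ_{u_m} − a_m ℓ_x` in the image ideal, and the inverse of the linear-part matrix (FC2 for
  `φ`) together with `a = Mξ` produces every `X_l`. This is where perfectness of the ground field enters the
  dictionary (tri-2's «inseparable residue growth» objection: with an inseparable residue step FC2 fails).

Sources: standard (unramified fibres of a base change at a separable point); folklore. No definitions.
-/

-- layout-mandated namespace `Summit.<Summit>.<Problem>.…` with Summit = Problem (single-conjunct summit)
set_option linter.dupNamespace false

open IsLocalRing MvPowerSeries
open Literature.AlgebraicGeometry.Resolution

namespace Summit.ResolutionOfSingularities.ResolutionOfSingularities.Theorems.SwitchingDichotomy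

namespace ChartStep

section FC2Aux

variable {d : ℕ} {κ : Type*} [Field κ]

open Polynomial in
/-- **Simple roots give unit factors**: if `a` is a simple root of `P ∈ κ[T]` (`P` separable) and
`V ∈ κ⟦X⟧` has constant term `a`, then `P(V) = (V − a)·U` with `U` a unit. [folklore] -/
theorem exists_aeval_eq_sub_mul_unit {P : κ[X]} (hP : P.Separable) {a : κ} (ha : P.IsRoot a)
    (V : MvPowerSeries (Fin d) κ) (hV : MvPowerSeries.constantCoeff V = a) :
    ∃ U : MvPowerSeries (Fin d) κ, IsUnit U ∧
      aeval V P = (V - MvPowerSeries.C a) * U := by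
  set Q := P /ₘ (Polynomial.X - Polynomial.C a) with hQ
  have hPQ : (Polynomial.X - Polynomial.C a) * Q = P := mul_divByMonic_eq_iff_isRoot.mpr ha
  refine ⟨aeval V Q, ?_, ?_⟩
  · -- `Q(a) = P'(a) ≠ 0`
    have hQa : Q.eval a ≠ 0 := by
      have hder : (derivative P).eval a = Q.eval a := by
        rw [← hPQ, derivative_mul, derivative_sub, derivative_X, derivative_C, sub_zero, one_mul,
          eval_add, eval_mul, eval_sub, eval_X, eval_C, sub_self, zero_mul, add_zero]
      rw [← hder]
      have h := hP.eval₂_derivative_ne_zero (RingHom.id κ) (x := a) (by rw [eval₂_id]; exact ha)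
      rwa [eval₂_id] at h
    rw [MvPowerSeries.isUnit_iff_constantCoeff]
    have : MvPowerSeries.constantCoeff (aeval V Q) = Q.eval a := by
      rw [aeval_def, hom_eval₂, hV]
      have hc : (MvPowerSeries.constantCoeff (σ := Fin d) (R := κ)).comp
          (algebraMap κ (MvPowerSeries (Fin d) κ)) = RingHom.id κ := by
        ext c
        simp [MvPowerSeries.algebraMap_apply]
      rw [hc, eval₂_id]
    rw [this]
    exact isUnit_iff_ne_zero.mpr hQa
  · conv_lhs => rw [← hPQ]
    rw [map_mul, map_sub, aeval_X, aeval_C, MvPowerSeries.algebraMap_apply, Algebra.algebraMap_self,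
      RingHom.id_apply]

/-- The linear-algebra identity behind FC2: with `C·M = 1` and `a = M·ξ`,
`Σ_m C_{lm} ((Σ_s M_{ms} Θ_s) − a_m L) = Θ_l − ξ_l L`. [folklore] -/
theorem sum_inverse_combination {A : Type*} [CommRing A] (f : κ →+* A)
    (Cm M : Matrix (Fin d) (Fin d) κ) (hCM : Cm * M = 1) (Θ : Fin d → A) (L : A) (a ξ : Fin d → κ)
    (ha : ∀ m, a m = ∑ s, M m s * ξ s) (l : Fin d) :
    ∑ m, f (Cm l m) * ((∑ s, f (M m s) * Θ s) - f (a m) * L) = Θ l - f (ξ l) * L := by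
  have h1 : ∑ m, f (Cm l m) * (∑ s, f (M m s) * Θ s) = Θ l := by
    have : ∀ m, f (Cm l m) * (∑ s, f (M m s) * Θ s) = ∑ s, f (Cm l m * M m s) * Θ s := by
      intro m
      rw [Finset.mul_sum]
      exact Finset.sum_congr rfl fun s _ => by rw [map_mul, mul_assoc]
    simp only [this]
    rw [Finset.sum_comm]
    have : ∀ s, ∑ m, f (Cm l m * M m s) * Θ s = f ((Cm * M) l s) * Θ s := by
      intro s
      rw [← Finset.sum_mul, ← map_sum, Matrix.mul_apply]
    simp only [this, hCM, Matrix.one_apply]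
    simp
  have h2 : ∑ m, f (Cm l m) * (f (a m) * L) = f (ξ l) * L := by
    have : ∀ m, f (Cm l m) * (f (a m) * L) = f (Cm l m * a m) * L := by
      intro m; rw [map_mul, mul_assoc]
    simp only [this]
    rw [← Finset.sum_mul, ← map_sum]
    congr 2
    simp only [ha, Finset.mul_sum]
    rw [Finset.sum_comm]
    have : ∀ s, ∑ m, Cm l m * (M m s * ξ s) = (Cm * M) l s * ξ s := by
      intro s
      rw [Matrix.mul_apply, Finset.sum_mul]
      exact Finset.sum_congr rfl fun m _ => by ring
    simp only [this, hCM, Matrix.one_apply]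
    simp
  simp only [mul_sub, Finset.sum_sub_distrib, h1, h2]

end FC2Aux

section FC2

variable {K : Type*} [Field K] (O : ValuationSubring K) {κ : Type*} [Field κ]
  (ι : IsLocalRing.ResidueField O →+* κ) {R : Subring K} (hR : R ≤ O.toSubring) [IsLocalRing R]
  (hdom : ∀ a : R, a ∈ maximalIdeal R ↔ O.valuation (a : K) < 1)
  {d : ℕ} (φ : R →+* MvPowerSeries (Fin d) κ)
  (h1 : ∀ r : R, constantCoeff (φ r) = ι (IsLocalRing.residue O (Subring.inclusion hR r)))
  (h2 : Ideal.map φ (Ideal.comap (Subring.inclusion hR) (maximalIdeal O)) =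
    Ideal.span (Set.range (X : Fin d → MvPowerSeries (Fin d) κ)))
  (u : Fin d → R) (hu : Ideal.span (Set.range u) = Ideal.comap (Subring.inclusion hR) (maximalIdeal O))
  {x : K} (hxR : x ∈ R) (hxv : O.valuation x < 1)
  (hB : blowupRing R x ≤ O.toSubring)
  (k₀ : Subfield κ) [PerfectField k₀] (halg : Algebra.IsAlgebraic k₀ κ)
  (hk₀ : ∀ a ∈ k₀, ∃ r : R, ι (IsLocalRing.residue O (Subring.inclusion hR r)) = a)
  (ξ : Fin d → κ) (j : Fin d) (hj : ξ j ≠ 0) (w : MvPowerSeries (Fin d) κ) (hwu : IsUnit w)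
  (hξ : ∀ (y : R) (_ : y ∈ Ideal.comap (Subring.inclusion hR) (maximalIdeal O)) (hyO : (y : K) / x ∈ O),
    ∑ l, coeff (Finsupp.single l 1) (φ y) * ξ l = ι (IsLocalRing.residue O ⟨(y : K) / x, hyO⟩))
  (hw : subst (fun s : Fin d => if s = j then (X j : MvPowerSeries (Fin d) κ) else X j * (X s + C (ξ s / ξ j)))
    (φ ⟨x, hxR⟩) = X j * w)
  (φ₁ : locAtCentre (blowupRing R x) O →+* MvPowerSeries (Fin d) κ)
  (hP1 : ∀ (r : R) (hr : (r : K) ∈ locAtCentre (blowupRing R x) O),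
    φ₁ ⟨r, hr⟩ = subst (fun s : Fin d => if s = j then (X j : MvPowerSeries (Fin d) κ)
      else X j * (X s + C (ξ s / ξ j))) (φ r))
  (hP3 : ∀ (z : locAtCentre (blowupRing R x) O) (hz : (z : K) ∈ O),
    constantCoeff (φ₁ z) = ι (IsLocalRing.residue O ⟨z, hz⟩))
  (hP4 : ∀ (y : R) (_ : y ∈ Ideal.comap (Subring.inclusion hR) (maximalIdeal O))
    (hmem : (y : K) / x ∈ locAtCentre (blowupRing R x) O),
    φ₁ ⟨(y : K) / x, hmem⟩ * (X j * w) = subst (fun s : Fin d => if s = j then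
      (X j : MvPowerSeries (Fin d) κ) else X j * (X s + C (ξ s / ξ j))) (φ y))

include hdom h1 h2 hu hxv halg hk₀ hj hwu hξ hw hP1 hP3 hP4 in
/-- **T2c — FC2 propagates: the centre of `O` on the quadratic transform generates `(X_1, …, X_d)`
under the new chart `φ₁`.** `⊆`: constant coefficients are residues, which vanish on the centre.
`⊇`: `X_j = φ₁(x)·w⁻¹`; for each generator `u_m` of the old centre let `a_m = res(u_m/x) ∈ κ` (algebraic
and SEPARABLE over the perfect field `k₀ ⊆ res(R)`), `P_m` its minimal polynomial with coefficients lifted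
to `R`, and `z_m = P_m(u_m/x)` — an element of the new centre with `φ₁ z_m ≡ (φ₁(u_m/x) − a_m)·unit`
modulo `(X_j)` (simple root); unwinding `φ₁(u_m/x)·w = W_m` (strict transforms) this puts the linear forms
`ℓ_{u_m} − a_m ℓ_x` in the image ideal, and inverting the linear-part matrix (FC2 for `φ`) and using
`a = M ξ` gives every `X_l`. [folklore] -/
theorem map_centre_eq_span_X :
    Ideal.map φ₁ (Ideal.comap (Subring.inclusion (locAtCentre_le hB)) (maximalIdeal O)) =
      Ideal.span (Set.range (X : Fin d → MvPowerSeries (Fin d) κ)) := by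
  classical
  haveI : IsDomain (MvPowerSeries (Fin d) κ) := NoZeroDivisors.to_isDomain _
  haveI := halg
  set hR₁ := locAtCentre_le (O := O) hB with hR₁_def
  set 𝔠 := Ideal.comap (Subring.inclusion hR) (maximalIdeal O) with h𝔠
  set 𝔫 := Ideal.comap (Subring.inclusion hR₁) (maximalIdeal O) with h𝔫
  set I := Ideal.map φ₁ 𝔫 with hI
  have hmc : maximalIdeal R = 𝔠 := maximalIdeal_eq_centre O hR hdom
  have hRR₁ : R ≤ locAtCentre (blowupRing R x) O := (le_blowupRing R x).trans (le_locAtCentre _ O)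
  have hdivB : ∀ y : R, y ∈ 𝔠 → (y : K) / x ∈ blowupRing R x :=
    fun y hy => div_mem_blowupRing x (hmc.symm ▸ hy)
  have hum : ∀ m, u m ∈ 𝔠 := fun m => by rw [← hu]; exact Ideal.subset_span ⟨m, rfl⟩
  have hu0 : ∀ m, constantCoeff (φ (u m)) = 0 :=
    fun m => constantCoeff_eq_zero_of_mem_centre O ι hR φ h1 (hum m)
  have hx𝔠 : (⟨x, hxR⟩ : R) ∈ 𝔠 := hmc ▸ (hdom _).mpr hxv
  -- residues on `R₁` and membership in the centre
  let ρ₁ : locAtCentre (blowupRing R x) O →+* κ :=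
    (ι.comp (IsLocalRing.residue O)).comp (Subring.inclusion hR₁)
  have hρ₁ : ∀ z : locAtCentre (blowupRing R x) O,
      ρ₁ z = ι (IsLocalRing.residue O ⟨(z : K), hR₁ z.2⟩) := fun z => rfl
  have hmem𝔫 : ∀ z : locAtCentre (blowupRing R x) O, z ∈ 𝔫 ↔ ρ₁ z = 0 := by
    intro z
    rw [h𝔫, Ideal.mem_comap, hρ₁, map_eq_zero_iff ι ι.injective, IsLocalRing.residue_eq_zero_iff]
    rfl
  -- (1) `I ≤ (X)`
  have hIle : I ≤ Ideal.span (Set.range (X : Fin d → MvPowerSeries (Fin d) κ)) := by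
    rw [hI, Ideal.map_le_iff_le_comap]
    intro z hz
    rw [Ideal.mem_comap, ← maximalIdeal_mvPowerSeries_eq_span,
      Literature.RingTheory.MvPowerSeries.Jets.mem_maximalIdeal_iff_constantCoeff_eq_zero,
      hP3 z (hR₁ z.2), ← hρ₁, ← hmem𝔫]
    exact hz
  apply le_antisymm hIle
  -- (2) `X_j ∈ I`
  have hxn : (⟨x, hRR₁ hxR⟩ : locAtCentre (blowupRing R x) O) ∈ 𝔫 := by
    rw [h𝔫, Ideal.mem_comap]
    exact (ValuationSubring.valuation_lt_one_iff O _).mpr hxv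
  have hXj : (X j : MvPowerSeries (Fin d) κ) ∈ I := by
    have h := Ideal.mem_map_of_mem φ₁ hxn
    rw [hP1 ⟨x, hxR⟩, hw] at h
    exact (Ideal.mul_unit_mem_iff_mem I hwu).mp h
  -- the forms `Θ_l` and `ℓ_x`
  set Θ : Fin d → MvPowerSeries (Fin d) κ :=
    fun l => if l = j then (1 : MvPowerSeries (Fin d) κ) else X l + C (ξ l / ξ j) with hΘ
  set ℓx : MvPowerSeries (Fin d) κ := ∑ l, C (coeff (Finsupp.single l 1) (φ ⟨x, hxR⟩)) * Θ l with hℓx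
  -- (3) `w = ℓ_x + X_j H'`
  obtain ⟨W', H', hW', hW'eq⟩ := exists_subst_blowFam_eq_X_mul j (fun s => ξ s / ξ j) (φ ⟨x, hxR⟩)
    (constantCoeff_eq_zero_of_mem_centre O ι hR φ h1 hx𝔠)
  have hwW' : w = W' := MvPowerSeries.X_mul_cancel (hw.symm.trans hW')
  have hweq : w = ℓx + X j * H' := by rw [hwW', hW'eq]
  -- (4) the linear-part matrix and its inverse
  have hX : ∀ l : Fin d, ∃ c : Fin d → MvPowerSeries (Fin d) κ, ∑ m, c m * φ (u m) = X l := by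
    intro l
    have hmem : (X l : MvPowerSeries (Fin d) κ) ∈ Ideal.map φ 𝔠 := h2 ▸ Ideal.subset_span ⟨l, rfl⟩
    rw [← hu, Ideal.map_span, ← Set.range_comp] at hmem
    exact Ideal.mem_span_range_iff_exists_fun.mp hmem
  choose c hc using hX
  let M : Matrix (Fin d) (Fin d) κ := fun m s => coeff (Finsupp.single s 1) (φ (u m))
  let Cm : Matrix (Fin d) (Fin d) κ := fun l m => constantCoeff (c l m)
  have hCM : Cm * M = 1 := by
    ext l s
    have := congrArg (coeff (Finsupp.single s 1)) (hc l)
    rw [coeff_single_sum_mul s (c l) (fun m => φ (u m)) hu0, coeff_single_X] at this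
    rw [Matrix.mul_apply, Matrix.one_apply]
    exact this
  let a : Fin d → κ := fun m => ι (IsLocalRing.residue O ⟨((u m : R) : K) / x, hB (hdivB (u m) (hum m))⟩)
  have ha : ∀ m, a m = ∑ s, M m s * ξ s := fun m => (hξ (u m) (hum m) _).symm
  -- (5) the key memberships `ℓ_{u_m} − a_m ℓ_x ∈ I`
  have key : ∀ m : Fin d, (∑ s, C (M m s) * Θ s) - C (a m) * ℓx ∈ I := by
    intro m
    -- the new generator `u_m / x` and its image
    set V₀ : locAtCentre (blowupRing R x) O :=
      ⟨((u m : R) : K) / x, le_locAtCentre _ O (hdivB (u m) (hum m))⟩ with hV₀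
    set V := φ₁ V₀ with hV
    have hVc : constantCoeff V = a m := hP3 V₀ _
    -- the minimal polynomial of `a_m` over `k₀`, separable
    set P := minpoly k₀ (a m) with hP
    have hsep : P.Separable := Algebra.IsSeparable.isSeparable k₀ (a m)
    set Pκ := P.map (algebraMap k₀ κ) with hPκ
    have hPκsep : Pκ.Separable := hsep.map
    have hroot : Pκ.IsRoot (a m) := by
      rw [Polynomial.IsRoot.def, hPκ, Polynomial.eval_map, ← Polynomial.aeval_def]
      exact minpoly.aeval k₀ (a m)
    have hdeg : Pκ.natDegree = P.natDegree := Polynomial.natDegree_map _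
    have hcoef : ∀ i, Pκ.coeff i = ((P.coeff i : k₀) : κ) := fun i => Polynomial.coeff_map _ _
    -- lift the coefficients to `R`
    choose r hr using fun i => hk₀ ((P.coeff i : k₀) : κ) (P.coeff i).2
    -- the element `z_m = P̃(u_m/x)` of the new centre
    set z : locAtCentre (blowupRing R x) O :=
      ∑ i ∈ Finset.range (P.natDegree + 1), Subring.inclusion hRR₁ (r i) * V₀ ^ i with hz
    have hρV₀ : ρ₁ V₀ = a m := rfl
    have hρr : ∀ i, ρ₁ (Subring.inclusion hRR₁ (r i)) = ((P.coeff i : k₀) : κ) := fun i => hr i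
    have hz𝔫 : z ∈ 𝔫 := by
      rw [hmem𝔫, hz, map_sum]
      simp only [map_mul, map_pow, hρV₀, hρr]
      have : Pκ.eval (a m) = 0 := hroot
      rw [Polynomial.eval_eq_sum_range, hdeg] at this
      simpa only [hcoef] using this
    have hφz : φ₁ z ∈ I := Ideal.mem_map_of_mem φ₁ hz𝔫
    -- `φ₁ z = Pκ(V) + X_j · S`
    choose H hH using fun i => exists_subst_blowFam_eq j (fun s => ξ s / ξ j) (φ (r i))
    have hφr : ∀ i, φ₁ (Subring.inclusion hRR₁ (r i)) = C (((P.coeff i : k₀) : κ)) + X j * H i := by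
      intro i
      have e : Subring.inclusion hRR₁ (r i) = ⟨(r i : K), hRR₁ (r i).2⟩ := rfl
      rw [e, hP1 (r i) (hRR₁ (r i).2), hH i, h1, hr i]
    have hT : Polynomial.aeval V Pκ ∈ I := by
      have hsum : φ₁ z = Polynomial.aeval V Pκ +
          X j * ∑ i ∈ Finset.range (P.natDegree + 1), H i * V ^ i := by
        rw [hz, map_sum, Polynomial.aeval_eq_sum_range, hdeg, Finset.mul_sum, ← Finset.sum_add_distrib]
        refine Finset.sum_congr rfl fun i _ => ?_
        rw [map_mul, map_pow, hφr i, hcoef i, MvPowerSeries.smul_eq_C_mul, ← hV]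
        ring
      have : Polynomial.aeval V Pκ = φ₁ z - X j * ∑ i ∈ Finset.range (P.natDegree + 1), H i * V ^ i := by
        rw [hsum]; ring
      rw [this]
      exact Ideal.sub_mem _ hφz (Ideal.mul_mem_right _ _ hXj)
    -- simple root ⇒ `V − C a_m ∈ I`
    obtain ⟨U, hU, hPU⟩ := exists_aeval_eq_sub_mul_unit hPκsep hroot V hVc
    have hVa : V - C (a m) ∈ I := by
      rw [hPU] at hT
      exact (Ideal.mul_unit_mem_iff_mem I hU).mp hT
    -- strict transform of `u_m`: `V · w = W_m = ℓ_{u_m} + X_j H_m`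
    obtain ⟨Wm, Hm, hWm, hWmeq⟩ := exists_subst_blowFam_eq_X_mul j (fun s => ξ s / ξ j) (φ (u m)) (hu0 m)
    have hVw : V * w = Wm := by
      apply MvPowerSeries.X_mul_cancel (i := j)
      rw [← hWm, ← hP4 (u m) (hum m) (le_locAtCentre _ O (hdivB (u m) (hum m))), hV]
      ring
    -- conclude
    have hmemI : (V - C (a m)) * w - X j * (Hm - C (a m) * H') ∈ I :=
      Ideal.sub_mem _ (Ideal.mul_mem_right _ _ hVa) (Ideal.mul_mem_right _ _ hXj)
    have heq : (∑ s, C (M m s) * Θ s) - C (a m) * ℓx = (V - C (a m)) * w - X j * (Hm - C (a m) * H') := by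
      rw [sub_mul, hVw, hWmeq, hweq]
      ring
    rw [heq]
    exact hmemI
  -- (6) `Θ_l − ξ_l ℓ_x ∈ I`
  have hΘ : ∀ l, Θ l - C (ξ l) * ℓx ∈ I := by
    intro l
    rw [← sum_inverse_combination (C : κ →+* MvPowerSeries (Fin d) κ) Cm M hCM Θ ℓx a ξ ha l]
    exact Ideal.sum_mem _ fun m _ => Ideal.mul_mem_left _ _ (key m)
  -- (7) every variable lies in `I`
  rw [Ideal.span_le]
  rintro _ ⟨l, rfl⟩
  by_cases hl : l = j
  · rw [hl]; exact hXj
  · have hid : (X l : MvPowerSeries (Fin d) κ) =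
        (Θ l - C (ξ l) * ℓx) - C (ξ l / ξ j) * (Θ j - C (ξ j) * ℓx) := by
      have hΘl : Θ l = X l + C (ξ l / ξ j) := if_neg hl
      have hΘj : Θ j = 1 := if_pos rfl
      have hC : C (ξ l / ξ j) * C (ξ j) = (C (ξ l) : MvPowerSeries (Fin d) κ) := by
        rw [← map_mul, div_mul_cancel₀ _ hj]
      rw [hΘl, hΘj]
      linear_combination (-ℓx) * hC
    rw [SetLike.mem_coe, hid]
    exact Ideal.sub_mem _ (hΘ l) (Ideal.mul_mem_left _ _ (hΘ j))

end FC2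

end ChartStep

end Summit.ResolutionOfSingularities.ResolutionOfSingularities.Theorems.SwitchingDichotomy
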